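import Mathlib
import HarnessLib
import Summits.AtomisticToContinuum.Crystallization.Theorems.PricedLinkCensusSoftFourRingsCapHexagon3

/-!
# Soft four-rings, endgame: a type-A vertex generates the anticuboctahedron

Support file for `SoftFourRings` (route `PricedLinkCensus`, sub-problem `Crystallization`),
endgame step (E4) of the evidence file (§12.8), point-level form.

`hexagon_structure` : in the hull-level setting at zero slack (conditional on Tammes-13), if some
vertex `v` carries type-A data `(a, b, c, d)`, then there are points `e, b₃, b₄, a₃, c₃, a₄, c₄`
such that the twelve points `v, b₄, d, e, b₃, b, a₃, a, a₄, c₃, c, c₄` are distinct, exhaust `X`,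
and have exactly the neighbourhoods of the anticuboctahedron (hexagon `v – b – e – b₄ – b₃ – d`,
caps `{a, a₃, a₄}`, `{c, c₃, c₄}`), listed in the order of `hcpTab` of the Literature.

**`Cap` variant** (seat c3 of stmt-AtomisticToContinuum-14234): identical to `PricedLinkCensusSoftFourRingsHexagon4`, except that the
global Tammes-13 hypothesis `(hT : musinTarasov2012_tammes_thirteen)` is replaced by the LOCAL covering
property of the twelve directions, `hT : ∀ p, ‖p‖ = 1 → ∃ x ∈ X, dist p x < 0.957` (no empty cap of
angular radius `57.18°`), which is all the two roots (`FacetCap`, `Interior`) ever used; the hT-free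
lemmas are not repeated (the original file is imported for them).
-/

namespace Summit.AtomisticToContinuum.Crystallization.Theorems.Cap

open Real RealInnerProductSpace Literature.Geometry.DiscreteGeometry

section Setting

open scoped Classical in
/-- **A type-A vertex generates the anticuboctahedron** (see the module docstring). -/
theorem hexagon_structure
    {X : Finset (EuclideanSpace ℝ (Fin 3))}
    {B : Finset (Finset (EuclideanSpace ℝ (Fin 3)))}
    (hT : ∀ p : EuclideanSpace ℝ (Fin 3), ‖p‖ = 1 → ∃ x ∈ X, dist p x < 0.957)
    (hX1 : ∀ y ∈ X, ‖y‖ = 1)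
    (hcard : X.card = 12)
    (hsepX : ∀ u ∈ X, ∀ u' ∈ X, u ≠ u' → ⟪u, u'⟫ ≤ 1 - 1 / (2 * (101 / 100 : ℝ) ^ 2))
    (hB : ∀ T ∈ B, ∃ u ∈ X, ∃ u' ∈ X, u ≠ u' ∧ 1 - (101 / 100 : ℝ) ^ 2 / 2 ≤ ⟪u, u'⟫ ∧ T = {u, u'})
    (hBcard : B.card = 24)
    (hdeg : ∀ v ∈ X, ∃ w : Fin 4 → EuclideanSpace ℝ (Fin 3), (∀ k, w k ∈ X) ∧ Function.Injective w ∧ (∀ k, w k ≠ v) ∧ (∀ k, ({v, w k} : Finset (EuclideanSpace ℝ (Fin 3))) ∈ B) ∧ ∀ y, ({v, y} : Finset (EuclideanSpace ℝ (Fin 3))) ∈ B → ∃ k, y = w k) {v a b c d : EuclideanSpace ℝ (Fin 3)} (hv : v ∈ X)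
    (hN : ∀ y, ({v, y} : Finset (EuclideanSpace ℝ (Fin 3))) ∈ B ↔ (y = a ∨ y = b ∨ y = c ∨ y = d))
    (hd : a ≠ b ∧ a ≠ c ∧ a ≠ d ∧ b ≠ c ∧ b ≠ d ∧ c ≠ d)
    (hab : ({a, b} : Finset (EuclideanSpace ℝ (Fin 3))) ∈ B) (hbc : ({b, c} : Finset (EuclideanSpace ℝ (Fin 3))) ∈ B)
    (hac : ({a, c} : Finset (EuclideanSpace ℝ (Fin 3))) ∉ B) (had : ({a, d} : Finset (EuclideanSpace ℝ (Fin 3))) ∉ B)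
    (hbd : ({b, d} : Finset (EuclideanSpace ℝ (Fin 3))) ∉ B) (hcd : ({c, d} : Finset (EuclideanSpace ℝ (Fin 3))) ∉ B) :
    ∃ e b₃ b₄ a₃ c₃ a₄ c₄ : EuclideanSpace ℝ (Fin 3),
      [v, b₄, d, e, b₃, b, a₃, a, a₄, c₃, c, c₄].Nodup ∧
      (∀ y, y ∈ X ↔ y ∈ [v, b₄, d, e, b₃, b, a₃, a, a₄, c₃, c, c₄]) ∧
      (∀ y, ({v, y} : Finset (EuclideanSpace ℝ (Fin 3))) ∈ B ↔ (y = a ∨ y = b ∨ y = c ∨ y = d)) ∧ (∀ y, ({b₄, y} : Finset (EuclideanSpace ℝ (Fin 3))) ∈ B ↔ (y = a₄ ∨ y = e ∨ y = c₄ ∨ y = b₃)) ∧ (∀ y, ({d, y} : Finset (EuclideanSpace ℝ (Fin 3))) ∈ B ↔ (y = a₃ ∨ y = b₃ ∨ y = c₃ ∨ y = v)) ∧ (∀ y, ({e, y} : Finset (EuclideanSpace ℝ (Fin 3))) ∈ B ↔ (y = a₄ ∨ y = b₄ ∨ y = c₄ ∨ y = b)) ∧ (∀ y, ({b₃, y}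 : Finset (EuclideanSpace ℝ (Fin 3))) ∈ B ↔ (y = a₃ ∨ y = d ∨ y = c₃ ∨ y = b₄)) ∧ (∀ y, ({b, y} : Finset (EuclideanSpace ℝ (Fin 3))) ∈ B ↔ (y = a ∨ y = v ∨ y = c ∨ y = e)) ∧ (∀ y, ({a₃, y} : Finset (EuclideanSpace ℝ (Fin 3))) ∈ B ↔ (y = d ∨ y = b₃ ∨ y = a ∨ y = a₄)) ∧ (∀ y, ({a, y} : Finset (EuclideanSpace ℝ (Fin 3))) ∈ B ↔ (y = v ∨ y = b ∨ y = a₃ ∨ y = a₄)) ∧ (∀ y, ({a₄, y} : Finset (EuclideanSpace ℝ (Fin 3))) ∈ B ↔ (y = e ∨ y = b₄ ∨ y = a ∨ y = a₃)) ∧ (∀ y, ({c₃, y} : Finset (EuclideanSpace ℝ (Fin 3))) ∈ B ↔ (y = d ∨ y = b₃ ∨ y = c ∨ y = c₄)) ∧ (∀ y, ({c, y} : Finset (EuclideanSpace ℝ (Fin 3))) ∈ B ↔ (y = v ∨ y = b ∨ y = c₃ ∨ y = c₄)) ∧ (∀ y, ({c₄, y} : Finset (EuclideanSpace ℝ (Fin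 3))) ∈ B ↔ (y = e ∨ y = b₄ ∨ y = c ∨ y = c₃)) := by
  have hva : ({v, a} : Finset (EuclideanSpace ℝ (Fin 3))) ∈ B := (hN a).2 (Or.inl rfl)
  have hvb : ({v, b} : Finset (EuclideanSpace ℝ (Fin 3))) ∈ B := (hN b).2 (Or.inr (Or.inl rfl))
  have hvc : ({v, c} : Finset (EuclideanSpace ℝ (Fin 3))) ∈ B := (hN c).2 (Or.inr (Or.inr (Or.inl rfl)))
  have hvd : ({v, d} : Finset (EuclideanSpace ℝ (Fin 3))) ∈ B := (hN d).2 (Or.inr (Or.inr (Or.inr rfl)))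
  have hbX : b ∈ X := (mem_of_mem_bonds hB hvb).2
  -- data at `b`, `d`, `e`
  obtain ⟨e, hev, hea, heb, hec, hed, hNb, hdb, hBav, hBvc, -, hae, hve, hce⟩ :=
    typeA_partner hT hX1 hcard hsepX hB hBcard hdeg hN hd hab hbc hac hbd
  have he : e ≠ v ∧ e ≠ a ∧ e ≠ b ∧ e ≠ c ∧ e ≠ d := ⟨hev, hea, heb, hec, hed⟩
  obtain ⟨a₃₀, b₃, c₃₀, hN₃₀, hd₃₀, hab₃₀, hbc₃₀, hac₃₀, hav₃₀, hbv₃, hcv₃₀⟩ :=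
    typeA_gamma hT hX1 hcard hsepX hB hBcard hdeg hN had hbd hcd
  obtain ⟨a₄₀, b₄, c₄₀, hN₄₀, hd₄₀, hab₄₀, hbc₄₀, hac₄₀, hab₄₀', hbb₄, hcb₄₀⟩ :=
    typeA_gamma hT hX1 hcard hsepX hB hBcard hdeg hNb hae hve hce
  -- no alternating 4-cycle, from both ends
  have heb₃ : e ≠ b₃ := fun h =>
    alternating_four_cycle_false hT hX1 hcard hsepX hB hBcard hdeg hv hN hd hab hbc hac had hbd hcd
      he hNb hae hve hce hN₃₀ hd₃₀ hab₃₀ hbc₃₀ hac₃₀ hav₃₀ hbv₃ hcv₃₀ h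
  have hde : d ≠ e := hed.symm
  have hdb₄ : d ≠ b₄ := fun h =>
    alternating_four_cycle_false hT hX1 hcard hsepX hB hBcard hdeg hbX hNb hdb hBav hBvc hac hae hve
      hce ⟨hd.2.2.2.2.1.symm, hd.2.2.1.symm, (ne_of_mem_bonds hB hvd).symm, hd.2.2.2.2.2.symm, hde⟩
      hN had hbd hcd hN₄₀ hd₄₀ hab₄₀ hbc₄₀ hac₄₀ hab₄₀' hbb₄ hcb₄₀ h
  -- orient the data at `d` and at `e` along the cells at `v` and at `b`
  obtain ⟨a₃, c₃, hN₃, hd₃, hab₃, hbc₃, hac₃, hav₃, hcv₃, haa₃, hcc₃⟩ : ∃ a₃ c₃ : EuclideanSpace ℝ (Fin 3),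
      (∀ y, ({d, y} : Finset (EuclideanSpace ℝ (Fin 3))) ∈ B ↔ (y = a₃ ∨ y = b₃ ∨ y = c₃ ∨ y = v)) ∧ (a₃ ≠ b₃ ∧ a₃ ≠ c₃ ∧ a₃ ≠ v ∧ b₃ ≠ c₃ ∧ b₃ ≠ v ∧ c₃ ≠ v) ∧
      ({a₃, b₃} : Finset (EuclideanSpace ℝ (Fin 3))) ∈ B ∧ ({b₃, c₃} : Finset (EuclideanSpace ℝ (Fin 3))) ∈ B ∧ ({a₃, c₃} : Finset (EuclideanSpace ℝ (Fin 3))) ∉ B ∧ ({a₃, v} : Finset (EuclideanSpace ℝ (Fin 3))) ∉ B ∧ ({c₃, v} : Finset (EuclideanSpace ℝ (Fin 3))) ∉ B ∧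
      ({a, a₃} : Finset (EuclideanSpace ℝ (Fin 3))) ∈ B ∧ ({c, c₃} : Finset (EuclideanSpace ℝ (Fin 3))) ∈ B := by
    rcases cells_end_at_wings hT hX1 hcard hsepX hB hBcard hdeg hv hN hd hab hbc hac had hbd hcd
        hN₃₀ hd₃₀ hab₃₀ hbc₃₀ hac₃₀ hav₃₀ hbv₃ hcv₃₀ with ⟨h1, h2⟩ | ⟨h1, h2⟩
    · exact ⟨a₃₀, c₃₀, hN₃₀, hd₃₀, hab₃₀, hbc₃₀, hac₃₀, hav₃₀, hcv₃₀, h1, h2⟩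
    · obtain ⟨hN', hd', hcb, hba, hca, hcv', -, hav'⟩ :=
        typeA_swap hN₃₀ hd₃₀ hab₃₀ hbc₃₀ hac₃₀ hav₃₀ hbv₃ hcv₃₀
      exact ⟨c₃₀, a₃₀, hN', hd', hcb, hba, hca, hcv', hav', h1, h2⟩
  clear hN₃₀ hd₃₀ hab₃₀ hbc₃₀ hac₃₀ hav₃₀ hcv₃₀
  obtain ⟨a₄, c₄, hN₄, hd₄, hab₄, hbc₄, hac₄, hab₄', hcb₄, haa₄, hcc₄⟩ : ∃ a₄ c₄ : EuclideanSpace ℝ (Fin 3),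
      (∀ y, ({e, y} : Finset (EuclideanSpace ℝ (Fin 3))) ∈ B ↔ (y = a₄ ∨ y = b₄ ∨ y = c₄ ∨ y = b)) ∧ (a₄ ≠ b₄ ∧ a₄ ≠ c₄ ∧ a₄ ≠ b ∧ b₄ ≠ c₄ ∧ b₄ ≠ b ∧ c₄ ≠ b) ∧
      ({a₄, b₄} : Finset (EuclideanSpace ℝ (Fin 3))) ∈ B ∧ ({b₄, c₄} : Finset (EuclideanSpace ℝ (Fin 3))) ∈ B ∧ ({a₄, c₄} : Finset (EuclideanSpace ℝ (Fin 3))) ∉ B ∧ ({a₄, b} : Finset (EuclideanSpace ℝ (Fin 3))) ∉ B ∧ ({c₄, b} : Finset (EuclideanSpace ℝ (Fin 3))) ∉ B ∧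
      ({a, a₄} : Finset (EuclideanSpace ℝ (Fin 3))) ∈ B ∧ ({c, c₄} : Finset (EuclideanSpace ℝ (Fin 3))) ∈ B := by
    rcases cells_end_at_wings hT hX1 hcard hsepX hB hBcard hdeg hbX hNb hdb hBav hBvc hac hae hve
        hce hN₄₀ hd₄₀ hab₄₀ hbc₄₀ hac₄₀ hab₄₀' hbb₄ hcb₄₀ with ⟨h1, h2⟩ | ⟨h1, h2⟩
    · exact ⟨a₄₀, c₄₀, hN₄₀, hd₄₀, hab₄₀, hbc₄₀, hac₄₀, hab₄₀', hcb₄₀, h1, h2⟩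
    · obtain ⟨hN', hd', hcb, hba, hca, hcb', -, hab''⟩ :=
        typeA_swap hN₄₀ hd₄₀ hab₄₀ hbc₄₀ hac₄₀ hab₄₀' hbb₄ hcb₄₀
      exact ⟨c₄₀, a₄₀, hN', hd', hcb, hba, hca, hcb', hab'', h1, h2⟩
  clear hN₄₀ hd₄₀ hab₄₀ hbc₄₀ hac₄₀ hab₄₀' hcb₄₀
  -- the wings
  obtain ⟨ha₃₄, hc₃₄, hNa, hNc, hBa, hBc, hNa₃, hNc₃, hNa₄, hNc₄, hexcl⟩ :=
    hexagon_wings hT hX1 hcard hsepX hB hBcard hdeg hN hd hab hbc hac had hbd hcd he hNb hae hve hce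
      hN₃ hd₃ hab₃ hbc₃ hac₃ hav₃ hbv₃ hcv₃ hN₄ hd₄ hab₄ hbc₄ hac₄ hab₄' hbb₄ hcb₄ haa₃ hcc₃ haa₄
      hcc₄ heb₃ hdb₄
  -- data at `b₃` and `b₄`
  obtain ⟨g, hgd, hga₃, hgb₃, hgc₃, hgv, hNb₃, -, -, -, -, -, -, -⟩ :=
    typeA_partner hT hX1 hcard hsepX hB hBcard hdeg hN₃ hd₃ hab₃ hbc₃ hac₃ hbv₃
  obtain ⟨g', hge, hga₄, hgb₄, hgc₄, hgb, hNb₄, -, -, -, -, -, -, -⟩ :=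
    typeA_partner hT hX1 hcard hsepX hB hBcard hdeg hN₄ hd₄ hab₄ hbc₄ hac₄ hbb₄
  -- bonds and elementary inequalities
  have hdb₃B : ({d, b₃} : Finset (EuclideanSpace ℝ (Fin 3))) ∈ B := (hN₃ b₃).2 (Or.inr (Or.inl rfl))
  have hda₃B : ({d, a₃} : Finset (EuclideanSpace ℝ (Fin 3))) ∈ B := (hN₃ a₃).2 (Or.inl rfl)
  have hdc₃B : ({d, c₃} : Finset (EuclideanSpace ℝ (Fin 3))) ∈ B := (hN₃ c₃).2 (Or.inr (Or.inr (Or.inl rfl)))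
  have heb₄B : ({e, b₄} : Finset (EuclideanSpace ℝ (Fin 3))) ∈ B := (hN₄ b₄).2 (Or.inr (Or.inl rfl))
  have hea₄B : ({e, a₄} : Finset (EuclideanSpace ℝ (Fin 3))) ∈ B := (hN₄ a₄).2 (Or.inl rfl)
  have hec₄B : ({e, c₄} : Finset (EuclideanSpace ℝ (Fin 3))) ∈ B := (hN₄ c₄).2 (Or.inr (Or.inr (Or.inl rfl)))
  have hva_ne : v ≠ a := ne_of_mem_bonds hB hva
  have hvb_ne : v ≠ b := ne_of_mem_bonds hB hvb
  have hvc_ne : v ≠ c := ne_of_mem_bonds hB hvc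
  have hvd_ne : v ≠ d := ne_of_mem_bonds hB hvd
  have hda₃_ne : d ≠ a₃ := ne_of_mem_bonds hB hda₃B
  have hdb₃_ne : d ≠ b₃ := ne_of_mem_bonds hB hdb₃B
  have hdc₃_ne : d ≠ c₃ := ne_of_mem_bonds hB hdc₃B
  have hea₄_ne : e ≠ a₄ := ne_of_mem_bonds hB hea₄B
  have heb₄_ne : e ≠ b₄ := ne_of_mem_bonds hB heb₄B
  have hec₄_ne : e ≠ c₄ := ne_of_mem_bonds hB hec₄B
  have n_a_a₃ : a ≠ a₃ := ne_of_mem_bonds hB haa₃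
  have n_a_a₄ : a ≠ a₄ := ne_of_mem_bonds hB haa₄
  have n_c_c₃ : c ≠ c₃ := ne_of_mem_bonds hB hcc₃
  have n_c_c₄ : c ≠ c₄ := ne_of_mem_bonds hB hcc₄
  have n_a_c₃ : a ≠ c₃ := fun h => hac (by rw [h, Finset.pair_comm]; exact hcc₃)
  have n_a_c₄ : a ≠ c₄ := fun h => hac (by rw [h, Finset.pair_comm]; exact hcc₄)
  have n_c_a₃ : c ≠ a₃ := fun h => hac (by rw [h]; exact haa₃)
  have n_c_a₄ : c ≠ a₄ := fun h => hac (by rw [h]; exact haa₄)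
  have n_a_b₃ : a ≠ b₃ := fun h => had (by rw [h, Finset.pair_comm]; exact hdb₃B)
  have n_c_b₃ : c ≠ b₃ := fun h => hcd (by rw [h, Finset.pair_comm]; exact hdb₃B)
  have n_b_b₃ : b ≠ b₃ := fun h => hbd (by rw [h, Finset.pair_comm]; exact hdb₃B)
  have n_a_b₄ : a ≠ b₄ := fun h => hae (by rw [h, Finset.pair_comm]; exact heb₄B)
  have n_c_b₄ : c ≠ b₄ := fun h => hce (by rw [h, Finset.pair_comm]; exact heb₄B)
  have n_v_b₄ : v ≠ b₄ := fun h => hve (by rw [h, Finset.pair_comm]; exact heb₄B)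
  have n_b_a₃ : b ≠ a₃ := fun h => hbd (by rw [h, Finset.pair_comm]; exact hda₃B)
  have n_b_c₃ : b ≠ c₃ := fun h => hbd (by rw [h, Finset.pair_comm]; exact hdc₃B)
  have n_v_a₄ : v ≠ a₄ := fun h => hve (by rw [h, Finset.pair_comm]; exact hea₄B)
  have n_v_c₄ : v ≠ c₄ := fun h => hve (by rw [h, Finset.pair_comm]; exact hec₄B)
  have n_a₃_c₄ : a₃ ≠ c₄ := by
    intro h
    have : c ∈ ({d, b₃, a, a₄} : Finset (EuclideanSpace ℝ (Fin 3))) := by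
      have hc' : ({a₃, c} : Finset (EuclideanSpace ℝ (Fin 3))) ∈ B := by rw [h, Finset.pair_comm]; exact hcc₄
      rcases (hNa₃ c).1 hc' with e1 | e1 | e1 | e1 <;> simp [e1]
    simp only [Finset.mem_insert, Finset.mem_singleton] at this
    rcases this with e1 | e1 | e1 | e1
    exacts [hd.2.2.2.2.2 e1, n_c_b₃ e1, hd.2.1 e1.symm, n_c_a₄ e1]
  have n_c₃_a₄ : c₃ ≠ a₄ := by
    intro h
    have : a ∈ ({d, b₃, c, c₄} : Finset (EuclideanSpace ℝ (Fin 3))) := by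
      have ha' : ({c₃, a} : Finset (EuclideanSpace ℝ (Fin 3))) ∈ B := by rw [h, Finset.pair_comm]; exact haa₄
      rcases (hNc₃ a).1 ha' with e1 | e1 | e1 | e1 <;> simp [e1]
    simp only [Finset.mem_insert, Finset.mem_singleton] at this
    rcases this with e1 | e1 | e1 | e1
    exacts [hd.2.2.1 e1, n_a_b₃ e1, hd.2.1 e1, n_a_c₄ e1]
  -- `b₃ ≠ b₄`
  have n_b₃_b₄ : b₃ ≠ b₄ := by
    intro h
    rw [← h] at heb₄B hab₄ hbc₄
    -- `e, a₄, c₄ ∈ N(b₃) = {a₃, d, c₃, g}`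
    have he' : e = g := by
      rcases (hNb₃ e).1 (by rw [Finset.pair_comm]; exact heb₄B) with e1 | e1 | e1 | e1
      exacts [absurd e1 hexcl.1, absurd e1 hde.symm, absurd e1 hexcl.2.1, e1]
    have ha₄' : a₄ = c₃ := by
      rcases (hNb₃ a₄).1 (by rw [Finset.pair_comm]; exact hab₄) with e1 | e1 | e1 | e1
      · exact absurd e1 ha₃₄.symm
      · exact absurd e1 hexcl.2.2.1.symm
      · exact e1
      · exact absurd (e1.trans he'.symm) hea₄_ne.symm
    exact hac₃ (by rw [← ha₄']; exact hBa)
  -- the twelve points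
  have hnd : [v, b₄, d, e, b₃, b, a₃, a, a₄, c₃, c, c₄].Nodup := by
    simp only [List.nodup_cons, List.mem_cons, List.not_mem_nil, not_or, or_false,
      not_false_eq_true, and_true, List.nodup_nil]
    exact ⟨⟨n_v_b₄, hvd_ne, (he.1).symm, (hd₃.2.2.2.2.1).symm, hvb_ne, (hd₃.2.2.1).symm, hva_ne, n_v_a₄, (hd₃.2.2.2.2.2).symm, hvc_ne, n_v_c₄⟩, ⟨(hdb₄).symm, (heb₄_ne).symm, (n_b₃_b₄).symm, hd₄.2.2.2.2.1, (hexcl.2.2.2.2.2.2.1).symm, (n_a_b₄).symm, (hd₄.1).symm, (hexcl.2.2.2.2.2.2.2).symm, (n_c_b₄).symm, hd₄.2.2.2.1⟩, ⟨(he.2.2.2.2).symm, hdb₃_ne, (hd.2.2.2.2.1).symm, hda₃_ne, (hd.2.2.1).symm, hexcl.2.2.1, hdc₃_ne, (hd.2.2.2.2.2).symm, hexcl.2.2.2.1⟩, ⟨heb₃, he.2.2.1, hexcl.1, he.2.1, hea₄_ne, hexcl.2.1, he.2.2.2.1, hec₄_ne⟩, ⟨(n_b_b₃).symm, (hd₃.1).symm,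 (n_a_b₃).symm, (hexcl.2.2.2.2.1).symm, hd₃.2.2.2.1, (n_c_b₃).symm, (hexcl.2.2.2.2.2.1).symm⟩, ⟨n_b_a₃, (hd.1).symm, (hd₄.2.2.1).symm, n_b_c₃, hd.2.2.2.1, (hd₄.2.2.2.2.2).symm⟩, ⟨(n_a_a₃).symm, ha₃₄, hd₃.2.1, (n_c_a₃).symm, n_a₃_c₄⟩, ⟨n_a_a₄, n_a_c₃, hd.2.1, n_a_c₄⟩, ⟨(n_c₃_a₄).symm, (n_c_a₄).symm, hd₄.2.1⟩, ⟨(n_c_c₃).symm, hc₃₄⟩, n_c_c₄⟩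
  have hmemX : ∀ y, y ∈ [v, b₄, d, e, b₃, b, a₃, a, a₄, c₃, c, c₄] → y ∈ X := by
    intro y hy
    simp only [List.mem_cons, List.not_mem_nil, or_false] at hy
    rcases hy with rfl | rfl | rfl | rfl | rfl | rfl | rfl | rfl | rfl | rfl | rfl | rfl
    · exact hv
    · exact (mem_of_mem_bonds hB heb₄B).2
    · exact (mem_of_mem_bonds hB hvd).2
    · exact (mem_of_mem_bonds hB heb₄B).1
    · exact (mem_of_mem_bonds hB hdb₃B).2
    · exact hbX
    · exact (mem_of_mem_bonds hB hda₃B).2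
    · exact (mem_of_mem_bonds hB hva).2
    · exact (mem_of_mem_bonds hB hea₄B).2
    · exact (mem_of_mem_bonds hB hdc₃B).2
    · exact (mem_of_mem_bonds hB hvc).2
    · exact (mem_of_mem_bonds hB hec₄B).2
  have hXeq : ∀ y, y ∈ X ↔ y ∈ [v, b₄, d, e, b₃, b, a₃, a, a₄, c₃, c, c₄] := by
    set L := [v, b₄, d, e, b₃, b, a₃, a, a₄, c₃, c, c₄] with hL
    have hsub : L.toFinset ⊆ X := fun y hy => hmemX y (List.mem_toFinset.1 hy)
    have hcardL : L.toFinset.card = 12 := by rw [List.toFinset_card_of_nodup hnd]; rfl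
    have heq : L.toFinset = X := Finset.eq_of_subset_of_card_le hsub (by rw [hcard, hcardL])
    intro y
    rw [← heq, List.mem_toFinset]
  -- `g = b₄`: `g ∈ X` is one of the twelve, and eleven are excluded
  have hgb₃B : ({b₃, g} : Finset (EuclideanSpace ℝ (Fin 3))) ∈ B := (hNb₃ g).2 (Or.inr (Or.inr (Or.inr rfl)))
  have hgX : g ∈ X := (mem_of_mem_bonds hB hgb₃B).2
  have hnotN : ∀ {u : EuclideanSpace ℝ (Fin 3)} {n₁ n₂ n₃ n₄ : EuclideanSpace ℝ (Fin 3)},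
      (∀ y, ({u, y} : Finset (EuclideanSpace ℝ (Fin 3))) ∈ B ↔ (y = n₁ ∨ y = n₂ ∨ y = n₃ ∨ y = n₄)) →
      b₃ ≠ n₁ → b₃ ≠ n₂ → b₃ ≠ n₃ → b₃ ≠ n₄ → g ≠ u := by
    intro u n₁ n₂ n₃ n₄ hNu h1 h2 h3 h4 hgu
    have : ({u, b₃} : Finset (EuclideanSpace ℝ (Fin 3))) ∈ B := by rw [← hgu, Finset.pair_comm]; exact hgb₃B
    rcases (hNu b₃).1 this with e1 | e1 | e1 | e1
    exacts [h1 e1, h2 e1, h3 e1, h4 e1]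
  have hg : g = b₄ := by
    have hgL := (hXeq g).1 hgX
    simp only [List.mem_cons, List.not_mem_nil, or_false] at hgL
    rcases hgL with h | h | h | h | h | h | h | h | h | h | h | h
    · exact absurd h hgv
    · exact h
    · exact absurd h hgd
    · exact absurd h (hnotN hN₄ hexcl.2.2.2.2.1.symm n_b₃_b₄ hexcl.2.2.2.2.2.1.symm n_b_b₃.symm)
    · exact absurd h hgb₃
    · exact absurd h (hnotN hNb n_a_b₃.symm hd₃.2.2.2.2.1 n_c_b₃.symm heb₃.symm)
    · exact absurd h hga₃
    · exact absurd h (hnotN hNa hd₃.2.2.2.2.1 n_b_b₃.symm hd₃.1.symm hexcl.2.2.2.2.1.symm)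
    · exact absurd h (hnotN hNa₄ heb₃.symm n_b₃_b₄ n_a_b₃.symm hd₃.1.symm)
    · exact absurd h hgc₃
    · exact absurd h (hnotN hNc hd₃.2.2.2.2.1 n_b_b₃.symm hd₃.2.2.2.1 hexcl.2.2.2.2.2.1.symm)
    · exact absurd h (hnotN hNc₄ heb₃.symm n_b₃_b₄ n_c_b₃.symm hd₃.2.2.2.1)
  rw [hg] at hNb₃ hgb₃B
  -- `g' = b₃`
  have hg' : g' = b₃ := by
    have : ({b₄, b₃} : Finset (EuclideanSpace ℝ (Fin 3))) ∈ B := by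
      rw [Finset.pair_comm]; exact hgb₃B
    rcases (hNb₄ b₃).1 this with e1 | e1 | e1 | e1
    exacts [absurd e1 hexcl.2.2.2.2.1.symm, absurd e1 heb₃.symm, absurd e1 hexcl.2.2.2.2.2.1.symm,
      e1.symm]
  rw [hg'] at hNb₄
  exact ⟨e, b₃, b₄, a₃, c₃, a₄, c₄, hnd, hXeq, hN, hNb₄, hN₃, hN₄, hNb₃, hNb, hNa₃, hNa, hNa₄, hNc₃, hNc,
    hNc₄⟩

end Setting

end Summit.AtomisticToContinuum.Crystallization.Theorems.Cap
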